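import Literature.MathematicalPhysics.QuantumFieldTheory.Balaban1983to89.Beta.PlaquetteVertex

/-!
# `Balaban1983to89.B12Eq439WilsonHessian` — [Balaban1987RG1] (4.38)–(4.39) p. 291: the second variation AT 𝐇 = 0 of the
localized Wilson action in exponential coordinates is the localized quadratic form of the lattice curl,
`⟨(δ²/δ𝐇²) Σ_{x,μ<ν} ζ_□′(x)[1 − Re tr(∂ exp iξ𝐇)(p_μν(x))]|_{𝐇=0}, H, H⟩ = ⟨∂^ξH, ζ_□′∂^ξH⟩` — PROVED

HONEST FRAMING (cell `lit-balaban`, verbatim): statement-level skeleton of published theorems with citation tags; proofs where landed; nothing here is a claim about the Yang–Mills mass gap.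

CITATION HEADER.  T. Bałaban, *Renormalization group approach to lattice gauge field theories. I. Generation of
effective actions in a small field approximation and a coupling constant renormalization in four dimensions*,
Commun. Math. Phys. **109** (1987) 249–301, doi:10.1007/bf01215223 [Balaban1987RG1] (cell paper B12; held text
`paper:balaban1987-cmp109-rg-i-small-field`, journal page = PDF page + 248; the displays were READ AS AN IMAGE from
the page render `b2b-balaban-ref1/pages/1987-cmp109-rg-I-small-field/…-p043-x2.png` (p. 291)).  Unit `lit-balaban-r09`
gen 4 (reader/typer of B12, display owner), SKELETON row `B12.Eq4.38-4.40` (fold owner r20; status `typed-existing`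
with the note «PARTIAL: (4.40) ↔ B5 (1.65)–(1.66) interface … are theorems; (4.38)–(4.39) not typed»); HOME
`run/shared/lean/pub/lit-balaban/`.  This file types (4.38) and PROVES (4.39) on the tree's kernel calculus of ordered
products of exponentials — `Beta.TransportVertices` (`holPath`, `D₁`, `D₂`, `hasDerivAt_holPath`, `hasDerivAt_D₁`,
`D₂_zero`) and `Beta.PlaquetteVertex` (`lcurl`, `trace_commSum`), imported and used BY NAME; (4.40)
«β_j⟨∂^ξH_j, ∂^ξH_j⟩ = β_jΔ_j» is the interface `B12Interfaces` (Seam 1) and is not touched.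

WHAT IS PRINTED (p. 291 [PDF 43], verbatim).  *«In this and the previous sections we were concerned with the term
𝐄^{(j)}(U_k(exp iB′V^{(k)})) − 𝐄^{(j)}(U_k(V^{(k)})) in the fluctuation field action. There is the second term under the
sum over j, the term
  β_j(g_{j−1})(A(U_j(exp iB′V^{(k)})) − A(U_k(V^{(k)}))).   (4.38)
We localize it by the partition of unity connected with the partition π_j, and we apply to it the whole procedure of
these two sections. As a result we obtain all the well controlled terms, and the terms in (4.34) with the function
𝐄^{(2)} replaced by the corresponding function calculated for the expression (4.38). By (4.35) it is equal to
  β_j(g_{j−1})⟨(δ²/δ𝐇²) Σ_{x,μ<ν} ζ_□′(x)[1 − Re tr(∂ exp iξ𝐇)(p_μν(x))]|_{𝐇=0}, H_j(□₀), H_j(□₀)⟩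
    = β_j(g_{j−1})⟨∂^ξH_j(□₀), ζ_□′∂^ξH_j(□₀)⟩,  □′ ∈ π_j.   (4.39)
Replacing the functions H_j(□₀) by H_j and summing over all □′ in ξZ⁴ yields the following expression, as the
expression corresponding to (4.37)
  β_j(g_{j−1})⟨∂^ξH_j, ∂^ξH_j⟩ = β_j(g_{j−1})Δ_j,   (4.40)
where Δ_j is given by the explicit formula (1.66) [10].»*  Conventions in force (printed elsewhere in the series):
the Wilson action `A^ξ(U) = Σ_p ξ^{d−4}[1 − Re tr U(∂p)]` with the NORMALIZED trace, `tr 1 = 1` ((0.2) p. 252;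
[Balaban1985BackgroundPropagators] p. 392 «⟨X, Y⟩ = tr XY», «the trace is normalized»); the plaquette variable
`U(∂p) = U(x,x+e_μ)U(x+e_μ,x+e_μ+e_ν)U(x+e_ν,x+e_μ+e_ν)⁻¹U(x,x+e_ν)⁻¹` (p. 252); the ξ-lattice plaquette derivative at
`U₀ = 1`, `(∂^ξH)(p_μν(x)) = ξ⁻¹(H(x,x+e_μ) + H(x+e_μ,x+e_μ+e_ν) − H(x+e_ν,x+e_ν+e_μ) − H(x,x+e_ν))`
([Balaban1985BackgroundPropagators] (3.4) p. 391 at `U₀ = 1`, with (3.5) `H(x,x′) = −H(x′,x)`); the pairing of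
𝔤-valued plaquette fields `⟨F, G⟩ = Σ_p ξ^d tr F(p)G(p)` (Riemann sum of the ξ-lattice).

HOW IT IS FORMALIZED (the dictionary; all modelling choices are here).  The carrier is the one of
`Beta.PlaquetteVertex`: a lattice `Λ` (any additive commutative group; `ξZ⁴ ∩ □₀`, a torus, …), directions `D`, a
frame `e : D → Λ` (`x + e μ` = the neighbour of `x` in direction `μ`), bond fields `a, H : Λ → D → 𝔸` with values in a
complete normed algebra `𝔸`; «Re tr» is ANY continuous linear TRACIAL functional `τ : 𝔸 →L[ℝ] ℝ` (`τ(ab) = τ(ba)`) —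
for `𝔸 = M_N(ℂ)` the normalized `rntr = N⁻¹ Re tr` of `Beta.PlaquetteVertex` (tracial: `rntr_comm`).  The configuration `exp iξ𝐇`
scaled by the variation parameter `s` is the bondwise exponential `U_s(b) = exp(s·a(b))` of the LETTERS
`a(b) = iξH(b)` (§4: `a = (ξ·I) • H` in a complex algebra), and its plaquette variable is the ordered product
`U_s(∂p_μν(x)) = e^{s a(x,μ)} e^{s a(x+e_μ,ν)} e^{−s a(x+e_ν,μ)} e^{−s a(x,ν)}` = `holPath ℝ (plaqLetters e a x μ ν) s`
(`plaqHolExp`; the inverse link variables ARE the exponentials of the negated letters, `e^{−b}e^{b} = e^{b}e^{−b} = 1`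
— B9 (3.5); in the tree as `Literature.Analysis.Calculus.exp_neg_mul_exp` / `exp_mul_exp_neg`, not re-proved here).  The second variation «(δ²/δ𝐇²)(…)|_{𝐇=0}» paired with `(H, H)` is the second
derivative at `s = 0` along the ray `s ↦ sH`, i.e. `deriv (deriv ·) 0` of the one-parameter functions below.
PROVED:
* §1 one word (any list of letters): `s ↦ 1 − τ(Π_j e^{s b_j})` is twice differentiable with
  `(d/ds)² |₀ = −τ((Σ_j b_j)²)` (`deriv2_wilsonWord_zero`: `D₂_zero` gives `(Σb)² + Σ_{i<j}[b_i,b_j]` and the tracial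
  `τ` kills the commutators, `trace_commSum`);
* §2 one plaquette: the letter sum is the lattice curl (`sum_plaqLetters`), hence
  `(d/ds)²|₀ [1 − τ U_s(∂p_μν(x))] = −τ((curl a)_μν(x)²)` (`deriv2_wilsonPlaq_zero`);
* §3 the LOCALIZED action `wilsonLocExp τ w ζ e a S s = Σ_{π∈S} w·ζ(x_π)·[1 − τ U_s(∂π)]` over any finite set `S` of
  plaquettes `π = (x, μ, ν)` (print: `x ∈ □₀-lattice, μ < ν`, weight `w = ξ^{d−4}`, `ζ = ζ_□′`):
  `(d/ds)²|₀ = −Σ_{π∈S} w ζ(x_π) τ((curl a)(π)²)` (`deriv2_wilsonLocExp_zero`, with the first-derivative formula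
  `deriv_wilsonLocExp` at every `s`);
* §4 the physical letters `a = iξH` in a complex algebra: `τ((iξF)²) = −ξ²τ(F²)` (`tau_sq_I_smul`), so
  **`eq439`**: `(d/ds)²|₀ Σ_{π} w ζ [1 − τ(∂ exp isξH)(π)] = Σ_{π} (w ξ⁴) ζ(x_π) τ((∂^ξH)(π)²)` = `curlPairing`, the
  localized pairing `⟨∂^ξH, ζ∂^ξH⟩` with `∂^ξH = ξ⁻¹·curl H` (`xiCurl`) and Riemann weight `w ξ⁴` (`= ξ^d` for
  `w = ξ^{d−4}`, `weight_eq_xi_pow`); the sentence «summing over all □′ … yields ⟨∂^ξH_j, ∂^ξH_j⟩» is linearity in ζ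
  (`curlPairing_add_weight`, `curlPairing_sum_weights`, `curlPairing_partition`: `Σ_□′ ζ_□′ = 1` on the plaquettes
  ⇒ `Σ_□′ ⟨∂^ξH, ζ_□′∂^ξH⟩ = ⟨∂^ξH, ∂^ξH⟩`);
(4.38) is TYPED as the named term `term438` (§0).
NOT HERE (not claimed): «the whole procedure of these two sections» applied to (4.38) (the localization/extension
machinery of (4.34)–(4.37), rows `B12.Eq4.34`–`B12.Eq4.37`); the identification of `H` with the minimizer
functions `H_j(□₀)` and the replacement `H_j(□₀) → H_j` (p. 290, row `B12.Eq4.35-4.37`'s lineage `B12HjFree290`);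
(4.40)–(4.41) (B5 (1.66), `B12Interfaces`); any positivity or bound; the instantiation `𝔸 = M_N(ℂ)`,
`τ = N⁻¹Re tr` (`Beta.PlaquetteVertex.rntr`, tracial by `rntr_comm`, continuous as every linear functional on a
finite-dimensional space) — immediate mathematically, not spelled out because Mathlib's two real-module structures on
complex matrices (entrywise, and by restriction of scalars from ℂ) are not definitionally equal.  No `sorry`, no axiom,
no named `Prop` fact; the only `def`s are objects with bodies (`term438`, `plaqLetters`, `plaqHolExp`, `wilsonLocExp`,
`xiCurl`, `curlPairing`).
-/

noncomputable section

namespace Literature.MathematicalPhysics.QuantumFieldTheory.Balaban1983to89.B12Eq439WilsonHessian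

open NormedSpace
open scoped BigOperators
open Literature.MathematicalPhysics.QuantumFieldTheory.Balaban1983to89.Beta.TransportVertices
  (holPath holPath_zero D₁ D₂ commSum hasDerivAt_holPath hasDerivAt_D₁ D₁_zero D₂_zero)
open Literature.MathematicalPhysics.QuantumFieldTheory.Balaban1983to89.Beta.PlaquetteVertex (lcurl trace_commSum)

/-! ## §0. (4.38): the term -/

section Term438

variable {𝒰 : Type*}

/-- **(4.38)** p. 291: *«There is the second term under the sum over j, the term
β_j(g_{j−1})(A(U_j(exp iB′V^{(k)})) − A(U_k(V^{(k)})))»* — the coefficient `β` = β_j(g_{j−1}) times the difference of the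
action `A` at the two configurations `U` = U_j(exp iB′V^{(k)}) and `U₀` = U_k(V^{(k)}) (carried as such; the maps
B′ ↦ U_j(exp iB′V^{(k)}) are the sibling modules' `rep`). [cite: Balaban1987RG1, (4.38) p.291] -/
def term438 (β : ℝ) (A : 𝒰 → ℝ) (U U₀ : 𝒰) : ℝ :=
  β * (A U - A U₀)

/-- Unfolding of (4.38). [cite: Balaban1987RG1, (4.38) p.291] -/
theorem term438_apply (β : ℝ) (A : 𝒰 → ℝ) (U U₀ : 𝒰) : term438 β A U U₀ = β * (A U - A U₀) := rfl

/-- (4.38) vanishes at `U = U₀` (no fluctuation, `B′ = 0`). [cite: Balaban1987RG1, (4.38) p.291] -/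
@[simp] theorem term438_self (β : ℝ) (A : 𝒰 → ℝ) (U₀ : 𝒰) : term438 β A U₀ U₀ = 0 := by
  simp [term438]

end Term438

/-! ## §1. One word: `s ↦ 1 − τ(Π_j exp(s b_j))` and its second derivative at `s = 0` -/

section Word

variable {𝔸 : Type*} [NormedRing 𝔸] [NormedAlgebra ℝ 𝔸] [CompleteSpace 𝔸]

/-- `(d/ds) τ(Π_j e^{s b_j}) = τ(D₁(s))` (a continuous linear functional commutes with the derivative of the transport
path, `Beta.TransportVertices.hasDerivAt_holPath`). [cite: Balaban1987RG1, (4.39) p.291] -/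
theorem hasDerivAt_tau_holPath (τ : 𝔸 →L[ℝ] ℝ) (l : List 𝔸) (s : ℝ) :
    HasDerivAt (fun t : ℝ => τ (holPath ℝ l t)) (τ (D₁ ℝ l s)) s :=
  τ.hasFDerivAt.comp_hasDerivAt s (hasDerivAt_holPath ℝ l s)

/-- `(d/ds) τ(D₁(s)) = τ(D₂(s))`. [cite: Balaban1987RG1, (4.39) p.291] -/
theorem hasDerivAt_tau_D₁ (τ : 𝔸 →L[ℝ] ℝ) (l : List 𝔸) (s : ℝ) :
    HasDerivAt (fun t : ℝ => τ (D₁ ℝ l t)) (τ (D₂ ℝ l s)) s :=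
  τ.hasFDerivAt.comp_hasDerivAt s (hasDerivAt_D₁ ℝ l s)

/-- The Wilson term of one word, `s ↦ 1 − τ(Π_j e^{s b_j})`, has derivative `−τ(D₁(s))`.
[cite: Balaban1987RG1, (4.39) p.291] -/
theorem hasDerivAt_wilsonWord (τ : 𝔸 →L[ℝ] ℝ) (l : List 𝔸) (s : ℝ) :
    HasDerivAt (fun t : ℝ => 1 - τ (holPath ℝ l t)) (-(τ (D₁ ℝ l s))) s :=
  (hasDerivAt_tau_holPath τ l s).const_sub 1

/-- … as an identity of functions: `deriv (s ↦ 1 − τ(Π e^{s b_j})) = s ↦ −τ(D₁(s))`. [cite: Balaban1987RG1, (4.39) p.291] -/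
theorem deriv_wilsonWord (τ : 𝔸 →L[ℝ] ℝ) (l : List 𝔸) :
    deriv (fun t : ℝ => 1 - τ (holPath ℝ l t)) = fun s => -(τ (D₁ ℝ l s)) :=
  funext fun s => (hasDerivAt_wilsonWord τ l s).deriv

/-- The first derivative is again differentiable, with derivative `−τ(D₂(s))`. [cite: Balaban1987RG1, (4.39) p.291] -/
theorem hasDerivAt_deriv_wilsonWord (τ : 𝔸 →L[ℝ] ℝ) (l : List 𝔸) (s : ℝ) :
    HasDerivAt (deriv (fun t : ℝ => 1 - τ (holPath ℝ l t))) (-(τ (D₂ ℝ l s))) s := by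
  rw [deriv_wilsonWord]
  exact (hasDerivAt_tau_D₁ τ l s).neg

omit [CompleteSpace 𝔸] in
/-- A tracial functional kills the ordered commutator sum (`Beta.PlaquetteVertex.trace_commSum`, continuous-linear
form). [cite: Balaban1987RG1, (4.39) p.291] -/
theorem tau_commSum (τ : 𝔸 →L[ℝ] ℝ) (hτ : ∀ a b : 𝔸, τ (a * b) = τ (b * a)) (l : List 𝔸) :
    τ (commSum l) = 0 := by
  have h := trace_commSum ℝ (τ : 𝔸 →ₗ[ℝ] ℝ) hτ l
  simpa using h

/-- **Second variation of one word at zero**: for a tracial `τ`,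
`(d/ds)²|_{s=0} [1 − τ(Π_j e^{s b_j})] = −τ((Σ_j b_j)²)` — `D₂(0) = (Σb)² + Σ_{i<j}[b_i, b_j]`
(`Beta.TransportVertices.D₂_zero`) and the commutators are traceless. [cite: Balaban1987RG1, (4.39) p.291] -/
theorem deriv2_wilsonWord_zero (τ : 𝔸 →L[ℝ] ℝ) (hτ : ∀ a b : 𝔸, τ (a * b) = τ (b * a)) (l : List 𝔸) :
    deriv (deriv (fun t : ℝ => 1 - τ (holPath ℝ l t))) 0 = -(τ (l.sum * l.sum)) := by
  rw [(hasDerivAt_deriv_wilsonWord τ l 0).deriv, D₂_zero, map_add, tau_commSum τ hτ l, add_zero]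

end Word

/-! ## §2. One plaquette: the letters, the plaquette variable in exponential coordinates, and its Hessian at 0 -/

section Plaquette

variable {𝔸 : Type*} [NormedRing 𝔸] [NormedAlgebra ℝ 𝔸] [CompleteSpace 𝔸]
  {Λ : Type*} [AddCommGroup Λ] {D : Type*}

/-- The four letters of the plaquette `p_μν(x) = ⟨x, x+e_μ, x+e_μ+e_ν, x+e_ν⟩` read along its boundary:
`a(x,μ), a(x+e_μ,ν), −a(x+e_ν,μ), −a(x,ν)` (the last two bonds traversed backwards, B9 (3.5) `a(x,x′) = −a(x′,x)`).
[cite: Balaban1987RG1, (4.39) p.291] -/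
def plaqLetters (e : D → Λ) (a : Λ → D → 𝔸) (x : Λ) (μ ν : D) : List 𝔸 :=
  [a x μ, a (x + e μ) ν, -(a (x + e ν) μ), -(a x ν)]

omit [NormedAlgebra ℝ 𝔸] [CompleteSpace 𝔸] in
/-- The signed letter sum of a plaquette is the lattice curl `(curl a)_μν(x) = a(x,μ) + a(x+e_μ,ν) − a(x+e_ν,μ) − a(x,ν)`
(`Beta.PlaquetteVertex.lcurl`, = ξ·(∂^ξa)(p_μν(x))). [cite: Balaban1987RG1, (4.39) p.291] -/
theorem sum_plaqLetters (e : D → Λ) (a : Λ → D → 𝔸) (x : Λ) (μ ν : D) :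
    (plaqLetters e a x μ ν).sum = lcurl e a x μ ν := by
  simp only [plaqLetters, List.sum_cons, List.sum_nil, lcurl]
  abel

/-- The plaquette variable in exponential coordinates along the variation parameter `s`:
`U_s(∂p_μν(x)) = e^{s a(x,μ)} e^{s a(x+e_μ,ν)} e^{−s a(x+e_ν,μ)} e^{−s a(x,ν)}` (= `holPath` of the letters).
[cite: Balaban1987RG1, (4.39) p.291] -/
def plaqHolExp (e : D → Λ) (a : Λ → D → 𝔸) (x : Λ) (μ ν : D) (s : ℝ) : 𝔸 :=
  holPath ℝ (plaqLetters e a x μ ν) s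

omit [CompleteSpace 𝔸] in
/-- Unfolding: the ordered product of the four link variables. [cite: Balaban1987RG1, (4.39) p.291] -/
theorem plaqHolExp_eq (e : D → Λ) (a : Λ → D → 𝔸) (x : Λ) (μ ν : D) (s : ℝ) :
    plaqHolExp e a x μ ν s
      = exp (s • a x μ) * (exp (s • a (x + e μ) ν) * (exp (-(s • a (x + e ν) μ)) * exp (-(s • a x ν)))) := by
  simp [plaqHolExp, plaqLetters, holPath, Beta.TransportVertices.holonomy, smul_neg]

omit [CompleteSpace 𝔸] in
/-- At `s = 0` the plaquette variable is `1`. [cite: Balaban1987RG1, (4.39) p.291] -/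
@[simp] theorem plaqHolExp_zero (e : D → Λ) (a : Λ → D → 𝔸) (x : Λ) (μ ν : D) : plaqHolExp e a x μ ν 0 = 1 := by
  simp [plaqHolExp]

/-- **Hessian of one plaquette term at zero**: for a tracial `τ`,
`(d/ds)²|_{s=0} [1 − τ U_s(∂p_μν(x))] = −τ((curl a)_μν(x)²)`. [cite: Balaban1987RG1, (4.39) p.291] -/
theorem deriv2_wilsonPlaq_zero (τ : 𝔸 →L[ℝ] ℝ) (hτ : ∀ a b : 𝔸, τ (a * b) = τ (b * a)) (e : D → Λ)
    (a : Λ → D → 𝔸) (x : Λ) (μ ν : D) :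
    deriv (deriv (fun t : ℝ => 1 - τ (plaqHolExp e a x μ ν t))) 0 = -(τ (lcurl e a x μ ν * lcurl e a x μ ν)) := by
  simp only [plaqHolExp]
  rw [deriv2_wilsonWord_zero τ hτ, sum_plaqLetters]

end Plaquette

/-! ## §3. The localized action `Σ_π w ζ(x_π)[1 − τ U_s(∂π)]` and its Hessian at 0 -/

section Localized

variable {𝔸 : Type*} [NormedRing 𝔸] [NormedAlgebra ℝ 𝔸] [CompleteSpace 𝔸]
  {Λ : Type*} [AddCommGroup Λ] {D : Type*}

/-- The LOCALIZED Wilson action in exponential coordinates along `s`: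
`Σ_{π=(x,μ,ν)∈S} w·ζ(x)·[1 − τ U_s(∂p_μν(x))]` — print: `Σ_{x,μ<ν} ζ_□′(x)[1 − Re tr(∂ exp iξ𝐇)(p_μν(x))]` with the action's
weight `w = ξ^{d−4}` ((0.2); `w = 1` at `d = 4`), over any finite set `S` of plaquettes. [cite: Balaban1987RG1, (4.39) p.291] -/
def wilsonLocExp (τ : 𝔸 →L[ℝ] ℝ) (w : ℝ) (ζ : Λ → ℝ) (e : D → Λ) (a : Λ → D → 𝔸) (S : Finset (Λ × D × D))
    (s : ℝ) : ℝ :=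
  ∑ π ∈ S, w * ζ π.1 * (1 - τ (plaqHolExp e a π.1 π.2.1 π.2.2 s))

omit [CompleteSpace 𝔸] in
/-- At `s = 0` (the configuration `U = 1`) the localized action vanishes when `τ` is normalized, `τ(1) = 1` («the
trace is normalized»). [cite: Balaban1987RG1, (4.39) p.291] -/
theorem wilsonLocExp_zero (τ : 𝔸 →L[ℝ] ℝ) (hτ1 : τ 1 = 1) (w : ℝ) (ζ : Λ → ℝ) (e : D → Λ) (a : Λ → D → 𝔸)
    (S : Finset (Λ × D × D)) : wilsonLocExp τ w ζ e a S 0 = 0 := by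
  simp [wilsonLocExp, hτ1]

/-- First derivative of the localized action at every `s`. [cite: Balaban1987RG1, (4.39) p.291] -/
theorem hasDerivAt_wilsonLocExp (τ : 𝔸 →L[ℝ] ℝ) (w : ℝ) (ζ : Λ → ℝ) (e : D → Λ) (a : Λ → D → 𝔸)
    (S : Finset (Λ × D × D)) (s : ℝ) :
    HasDerivAt (wilsonLocExp τ w ζ e a S)
      (∑ π ∈ S, w * ζ π.1 * -(τ (D₁ ℝ (plaqLetters e a π.1 π.2.1 π.2.2) s))) s := by
  have h : ∀ π ∈ S, HasDerivAt (fun t : ℝ => w * ζ π.1 * (1 - τ (plaqHolExp e a π.1 π.2.1 π.2.2 t)))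
      (w * ζ π.1 * -(τ (D₁ ℝ (plaqLetters e a π.1 π.2.1 π.2.2) s))) s := fun π _ =>
    (hasDerivAt_wilsonWord τ (plaqLetters e a π.1 π.2.1 π.2.2) s).const_mul (w * ζ π.1)
  have hsum := HasDerivAt.fun_sum h
  exact hsum

/-- … as an identity of functions. [cite: Balaban1987RG1, (4.39) p.291] -/
theorem deriv_wilsonLocExp (τ : 𝔸 →L[ℝ] ℝ) (w : ℝ) (ζ : Λ → ℝ) (e : D → Λ) (a : Λ → D → 𝔸)
    (S : Finset (Λ × D × D)) :
    deriv (wilsonLocExp τ w ζ e a S)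
      = fun s => ∑ π ∈ S, w * ζ π.1 * -(τ (D₁ ℝ (plaqLetters e a π.1 π.2.1 π.2.2) s)) :=
  funext fun s => (hasDerivAt_wilsonLocExp τ w ζ e a S s).deriv

/-- Second derivative of the localized action at every `s`. [cite: Balaban1987RG1, (4.39) p.291] -/
theorem hasDerivAt_deriv_wilsonLocExp (τ : 𝔸 →L[ℝ] ℝ) (w : ℝ) (ζ : Λ → ℝ) (e : D → Λ) (a : Λ → D → 𝔸)
    (S : Finset (Λ × D × D)) (s : ℝ) :
    HasDerivAt (deriv (wilsonLocExp τ w ζ e a S))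
      (∑ π ∈ S, w * ζ π.1 * -(τ (D₂ ℝ (plaqLetters e a π.1 π.2.1 π.2.2) s))) s := by
  rw [deriv_wilsonLocExp]
  have h : ∀ π ∈ S, HasDerivAt (fun t : ℝ => w * ζ π.1 * -(τ (D₁ ℝ (plaqLetters e a π.1 π.2.1 π.2.2) t)))
      (w * ζ π.1 * -(τ (D₂ ℝ (plaqLetters e a π.1 π.2.1 π.2.2) s))) s := fun π _ =>
    ((hasDerivAt_tau_D₁ τ (plaqLetters e a π.1 π.2.1 π.2.2) s).neg).const_mul (w * ζ π.1)
  exact HasDerivAt.fun_sum h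

/-- **Hessian of the localized action at `U = 1`**: for a tracial `τ`,
`(d/ds)²|_{s=0} Σ_π w ζ(x_π)[1 − τ U_s(∂π)] = −Σ_π w ζ(x_π) τ((curl a)(π)²)`. [cite: Balaban1987RG1, (4.39) p.291] -/
theorem deriv2_wilsonLocExp_zero (τ : 𝔸 →L[ℝ] ℝ) (hτ : ∀ a b : 𝔸, τ (a * b) = τ (b * a)) (w : ℝ) (ζ : Λ → ℝ)
    (e : D → Λ) (a : Λ → D → 𝔸) (S : Finset (Λ × D × D)) :
    deriv (deriv (wilsonLocExp τ w ζ e a S)) 0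
      = -∑ π ∈ S, w * ζ π.1 * τ (lcurl e a π.1 π.2.1 π.2.2 * lcurl e a π.1 π.2.1 π.2.2) := by
  rw [(hasDerivAt_deriv_wilsonLocExp τ w ζ e a S 0).deriv, ← Finset.sum_neg_distrib]
  refine Finset.sum_congr rfl fun π _ => ?_
  rw [D₂_zero, map_add, tau_commSum τ hτ, add_zero, sum_plaqLetters]
  ring

end Localized

/-! ## §4. The physical letters `a = iξH`: (4.39) -/

section Physical

variable {𝔸 : Type*} [NormedRing 𝔸] [NormedAlgebra ℂ 𝔸] [CompleteSpace 𝔸]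
  {Λ : Type*} [AddCommGroup Λ] {D : Type*}

omit [CompleteSpace 𝔸] in
/-- The curl is ℂ-linear in the field: `curl(c•H) = c•curl H`. [cite: Balaban1987RG1, (4.39) p.291] -/
theorem lcurl_smul (c : ℂ) (e : D → Λ) (H : Λ → D → 𝔸) (x : Λ) (μ ν : D) :
    lcurl e (c • H) x μ ν = c • lcurl e H x μ ν := by
  simp only [lcurl, Pi.smul_apply, smul_sub]

omit [CompleteSpace 𝔸] in
/-- `τ((iξF)²) = −ξ²τ(F²)` for a real-linear functional on a complex algebra. [cite: Balaban1987RG1, (4.39) p.291] -/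
theorem tau_sq_I_smul (τ : 𝔸 →L[ℝ] ℝ) (ξ : ℝ) (F : 𝔸) :
    τ ((((ξ : ℂ) * Complex.I) • F) * (((ξ : ℂ) * Complex.I) • F)) = -(ξ ^ 2 * τ (F * F)) := by
  rw [smul_mul_smul_comm]
  have hc : ((ξ : ℂ) * Complex.I) * ((ξ : ℂ) * Complex.I) = ((-(ξ ^ 2) : ℝ) : ℂ) := by
    have hI : Complex.I * Complex.I = -1 := Complex.I_mul_I
    push_cast
    linear_combination (ξ : ℂ) ^ 2 * hI
  rw [hc, Complex.coe_smul, map_smul, smul_eq_mul]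
  ring

/-- The ξ-lattice plaquette derivative at `U₀ = 1`: `(∂^ξH)(p_μν(x)) = ξ⁻¹(H(x,μ) + H(x+e_μ,ν) − H(x+e_ν,μ) − H(x,ν))`
([Balaban1985BackgroundPropagators] (3.4) at `U₀ = 1`). [cite: Balaban1987RG1, (4.39) p.291] -/
def xiCurl (ξ : ℝ) (e : D → Λ) (H : Λ → D → 𝔸) (x : Λ) (μ ν : D) : 𝔸 :=
  (ξ⁻¹ : ℝ) • lcurl e H x μ ν

omit [CompleteSpace 𝔸] in
/-- Unfolding of `∂^ξH`. [cite: Balaban1987RG1, (4.39) p.291] -/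
theorem xiCurl_apply (ξ : ℝ) (e : D → Λ) (H : Λ → D → 𝔸) (x : Λ) (μ ν : D) :
    xiCurl ξ e H x μ ν = (ξ⁻¹ : ℝ) • lcurl e H x μ ν := rfl

omit [CompleteSpace 𝔸] in
/-- `ξ⁴ τ((∂^ξH)²) = ξ² τ((curl H)²)`. [cite: Balaban1987RG1, (4.39) p.291] -/
theorem xi_pow_four_mul_tau_xiCurl_sq (τ : 𝔸 →L[ℝ] ℝ) {ξ : ℝ} (hξ : ξ ≠ 0) (e : D → Λ) (H : Λ → D → 𝔸) (x : Λ)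
    (μ ν : D) :
    ξ ^ 4 * τ (xiCurl ξ e H x μ ν * xiCurl ξ e H x μ ν) = ξ ^ 2 * τ (lcurl e H x μ ν * lcurl e H x μ ν) := by
  rw [xiCurl_apply, smul_mul_smul_comm, map_smul, smul_eq_mul]
  field_simp

/-- The localized pairing `⟨∂^ξH, ζ ∂^ξH⟩ = Σ_{π=(x,μ,ν)∈S} wd·ζ(x)·τ((∂^ξH)(π)²)` with the Riemann weight `wd` (= ξ^d)
of the ξ-lattice pairing `⟨F, G⟩ = Σ_p ξ^d tr F(p)G(p)`. [cite: Balaban1987RG1, (4.39) p.291] -/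
def curlPairing (τ : 𝔸 →L[ℝ] ℝ) (wd : ℝ) (ζ : Λ → ℝ) (e : D → Λ) (ξ : ℝ) (H : Λ → D → 𝔸)
    (S : Finset (Λ × D × D)) : ℝ :=
  ∑ π ∈ S, wd * ζ π.1 * τ (xiCurl ξ e H π.1 π.2.1 π.2.2 * xiCurl ξ e H π.1 π.2.1 π.2.2)

/-- The action's weight times `ξ⁴` is the pairing's weight: `ξ^{d−4}·ξ⁴ = ξ^d` (`d ≥ 4`; at `d = 4`, `w = 1` and the
weight is `ξ⁴`). [cite: Balaban1987RG1, (4.39) p.291] -/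
theorem weight_eq_xi_pow (ξ : ℝ) {d : ℕ} (hd : 4 ≤ d) : ξ ^ (d - 4) * ξ ^ 4 = ξ ^ d := by
  rw [← pow_add, Nat.sub_add_cancel hd]

/-- **(4.39)** p. 291, PROVED: *«⟨(δ²/δ𝐇²) Σ_{x,μ<ν} ζ_□′(x)[1 − Re tr(∂ exp iξ𝐇)(p_μν(x))]|_{𝐇=0}, H_j(□₀), H_j(□₀)⟩
= ⟨∂^ξH_j(□₀), ζ_□′∂^ξH_j(□₀)⟩»* — for every continuous linear tracial `τ` («Re tr»), every weight function `ζ`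
(«ζ_□′»), action weight `w` («ξ^{d−4}»), `ξ ≠ 0`, every bond field `H` («H_j(□₀)») on every lattice `(Λ, e)` and every
finite set `S` of plaquettes («x, μ < ν»): the second derivative at `s = 0` of
`s ↦ Σ_{π∈S} w ζ(x_π)[1 − τ(∂ exp isξH)(π)]` equals `Σ_{π∈S} (wξ⁴) ζ(x_π) τ((∂^ξH)(π)²)` = `curlPairing τ (w ξ⁴) ζ e ξ H S`.
[cite: Balaban1987RG1, (4.39) p.291] -/
theorem eq439 (τ : 𝔸 →L[ℝ] ℝ) (hτ : ∀ a b : 𝔸, τ (a * b) = τ (b * a)) (w : ℝ) (ζ : Λ → ℝ) (e : D → Λ) {ξ : ℝ}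
    (hξ : ξ ≠ 0) (H : Λ → D → 𝔸) (S : Finset (Λ × D × D)) :
    deriv (deriv (wilsonLocExp τ w ζ e (((ξ : ℂ) * Complex.I) • H) S)) 0 = curlPairing τ (w * ξ ^ 4) ζ e ξ H S := by
  rw [deriv2_wilsonLocExp_zero τ hτ, curlPairing, ← Finset.sum_neg_distrib]
  refine Finset.sum_congr rfl fun π _ => ?_
  rw [lcurl_smul, tau_sq_I_smul]
  have h4 := xi_pow_four_mul_tau_xiCurl_sq τ hξ e H π.1 π.2.1 π.2.2
  calc -(w * ζ π.1 * -(ξ ^ 2 * τ (lcurl e H π.1 π.2.1 π.2.2 * lcurl e H π.1 π.2.1 π.2.2)))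
        = w * ζ π.1 * (ξ ^ 2 * τ (lcurl e H π.1 π.2.1 π.2.2 * lcurl e H π.1 π.2.1 π.2.2)) := by ring
    _ = w * ζ π.1 * (ξ ^ 4 * τ (xiCurl ξ e H π.1 π.2.1 π.2.2 * xiCurl ξ e H π.1 π.2.1 π.2.2)) := by rw [h4]
    _ = w * ξ ^ 4 * ζ π.1 * τ (xiCurl ξ e H π.1 π.2.1 π.2.2 * xiCurl ξ e H π.1 π.2.1 π.2.2) := by ring

/-- (4.39), one plaquette: `(d/ds)²|₀ [1 − τ(∂ exp isξH)(p_μν(x))] = ξ⁴ τ((∂^ξH)(p_μν(x))²) = ξ² τ((curl H)_μν(x)²)`.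
[cite: Balaban1987RG1, (4.39) p.291] -/
theorem eq439_plaq (τ : 𝔸 →L[ℝ] ℝ) (hτ : ∀ a b : 𝔸, τ (a * b) = τ (b * a)) (e : D → Λ) (ξ : ℝ)
    (H : Λ → D → 𝔸) (x : Λ) (μ ν : D) :
    deriv (deriv (fun t : ℝ => 1 - τ (plaqHolExp e (((ξ : ℂ) * Complex.I) • H) x μ ν t))) 0
      = ξ ^ 2 * τ (lcurl e H x μ ν * lcurl e H x μ ν) := by
  rw [deriv2_wilsonPlaq_zero τ hτ, lcurl_smul, tau_sq_I_smul, neg_neg]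

omit [CompleteSpace 𝔸] in
/-- The pairing is additive in the weight function: `⟨∂H, (ζ+ζ′)∂H⟩ = ⟨∂H, ζ∂H⟩ + ⟨∂H, ζ′∂H⟩`.
[cite: Balaban1987RG1, (4.40) p.291] -/
theorem curlPairing_add_weight (τ : 𝔸 →L[ℝ] ℝ) (wd : ℝ) (ζ ζ' : Λ → ℝ) (e : D → Λ) (ξ : ℝ) (H : Λ → D → 𝔸)
    (S : Finset (Λ × D × D)) :
    curlPairing τ wd (ζ + ζ') e ξ H S = curlPairing τ wd ζ e ξ H S + curlPairing τ wd ζ' e ξ H S := by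
  simp only [curlPairing, Pi.add_apply, ← Finset.sum_add_distrib]
  refine Finset.sum_congr rfl fun π _ => ?_
  ring

omit [CompleteSpace 𝔸] in
/-- … and over any finite family of weight functions: `Σ_i ⟨∂H, ζ_i∂H⟩ = ⟨∂H, (Σ_i ζ_i)∂H⟩`.
[cite: Balaban1987RG1, (4.40) p.291] -/
theorem curlPairing_sum_weights {ι : Type*} (I : Finset ι) (τ : 𝔸 →L[ℝ] ℝ) (wd : ℝ) (ζ : ι → Λ → ℝ) (e : D → Λ)
    (ξ : ℝ) (H : Λ → D → 𝔸) (S : Finset (Λ × D × D)) :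
    ∑ i ∈ I, curlPairing τ wd (ζ i) e ξ H S = curlPairing τ wd (fun x => ∑ i ∈ I, ζ i x) e ξ H S := by
  simp only [curlPairing]
  rw [Finset.sum_comm]
  refine Finset.sum_congr rfl fun π _ => ?_
  rw [Finset.mul_sum, Finset.sum_mul]

omit [CompleteSpace 𝔸] in
/-- *«Replacing the functions H_j(□₀) by H_j and summing over all □′ … yields ⟨∂^ξH_j, ∂^ξH_j⟩»* — the summation over
the cubes: if the weights form a partition of unity on the plaquettes of `S` (`Σ_{□′} ζ_□′(x_π) = 1`), then
`Σ_{□′} ⟨∂^ξH, ζ_□′∂^ξH⟩ = ⟨∂^ξH, ∂^ξH⟩` (the unweighted pairing, `ζ ≡ 1`). [cite: Balaban1987RG1, (4.40) p.291] -/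
theorem curlPairing_partition {ι : Type*} (I : Finset ι) (τ : 𝔸 →L[ℝ] ℝ) (wd : ℝ) (ζ : ι → Λ → ℝ) (e : D → Λ)
    (ξ : ℝ) (H : Λ → D → 𝔸) (S : Finset (Λ × D × D)) (hpart : ∀ π ∈ S, ∑ i ∈ I, ζ i π.1 = 1) :
    ∑ i ∈ I, curlPairing τ wd (ζ i) e ξ H S = curlPairing τ wd (fun _ => 1) e ξ H S := by
  rw [curlPairing_sum_weights]
  simp only [curlPairing]
  refine Finset.sum_congr rfl fun π hπ => ?_
  rw [hpart π hπ]

end Physical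

end Literature.MathematicalPhysics.QuantumFieldTheory.Balaban1983to89.B12Eq439WilsonHessian

end
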